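import Literature.RingTheory.FormalGroups.PadicLogTypeSeries
import Literature.NumberTheory.PAdicHodge.BdRPlusLogTypeSeriesAdd
import Mathlib.RingTheory.Localization.FractionRing
import HarnessLib

/-!
# Additivity of the `p`-adic log-type sums along a formal group law: `Λ(G(y₀,y₁)) = Λ(y₀) + Λ(y₁)` in `B^_(p)`

Topic `Literature/RingTheory/FormalGroups`; namespace `Literature.RingTheory.FormalGroups.PadicLogSeries`. THEOREMS ONLY (no
definition, no named fact, no instance, no `sorry`). Sequel of `PadicLogTypeSeries` (the sums `Λᵇ_N(y,z) = p^N·Σ (b_m/m) yᵐ ∈ B^_(p)`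
at a `p`-nilpotent `y`, `y^N = p z`). DATA: a domain `B` of characteristic `0` with `ι : ℤ_p → B`, a rational series `f = Σ c_m Xᵐ`
with `ι(b_m) = m·c_m` (read in the fraction field of `B`), and an INTEGRAL two-variable series `G ∈ ℤ⟦X₀,X₁⟧` without constant term
with `f(G(X₀,X₁)) = f(X₀) + f(X₁)` — e.g. `f = log_W`, `G = F_W` for a Weierstrass model over `ℤ` (tree `formalLog_subst_formalGroupLaw`).

* §1 in the fraction field `K`: `T_m(x,z) = p^N c_m xᵐ`, `S_M(x,z) = p^N Σ_{m<M} c_{m+1} x^{m+1}` (`algebraMap_term_eq`,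
  `algebraMap_partialSum_eq`);
* §2 bookkeeping `v_p(k) ≤ n + N` for `k ≤ 4nN`;
* §3 ★ `exists_partialSum_aeval_truncTotal_sub_eq` — the TRUNCATED FUNCTIONAL EQUATION IN `B`: for `M = 4nN ≤ D`, `g' = G_D(y)`,
  `S_M(g') − S_M(y₀) − S_M(y₁) = p^{N+n}·w` at index `2N` (in `K` the defect is `p^{2N} Σ c_{m+1} H_{m+1}(y)` by the tree's pure-algebra
  `PAdicHodge.LogTypeSeries.aeval_sum_truncTotal_sub`, `H_{m+1}(y) ∈ (y₀,y₁)^{M+1} ⊆ p^{2n}B` and `p^{n+N} c_{m+1} = ι(b_{m+1} d)`;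
  pulled back along `B ↪ K`);
* §4 ★★ `logSum_eq_add_of_forall_sub_aeval_mem` — ADDITIVITY at index `2N` for every `p`-adic value `g` of `G(y₀,y₁)`
  (`g ≡ G_D(y) (mod pᵏ)` for all large `D`), and §5 ★★ `logSum_eq_add_of_forall_sub_aeval_mem'` — the same at index `N`
  (descent by `Λ_{2N} = p^N Λ_N` and `p`-torsion-freeness of `B^_(p)`, `eq_zero_of_pow_mul_eq_zero`).

Consequence (next files): `[m]`-compatibility `Λ([m]_G y) = m·Λ(y)` by induction, hence the EXACT Dieudonné–Honda relation on canonical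
lifts of `[p]`-division sequences (brick B4 of the φ-road of line `kato_lever`, crux K★ `stmt-BirchSwinnertonDyer-22226`, memo
`Lines/kato-lever-K2-phi-road.md`), and `φ·log[x] = p·log[x]` for Teichmüller lifts. Infrastructure only: BSD / K★ are not proved by any of this.

## References
* J. H. Silverman, *The Arithmetic of Elliptic Curves* (2009), IV.2, IV.5.2 (`log_F(F(X,Y)) = log_F X + log_F Y`). [SilvermanAEC2009]
* P. Colmez, *Périodes p-adiques des variétés abéliennes*, Math. Ann. 292 (1992), §2. [Colmez1992PeriodesAbeliennes]
* M. Hazewinkel, *Formal Groups and Applications* (1978), Ch. I §2.1–2.3. [Hazewinkel1978]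
* L. Berger, *Représentations p-adiques et équations différentielles*, Invent. Math. 148 (2002), §1.2. [BergerLaurent2002]
-/

noncomputable section

open Finset

namespace Literature.RingTheory.FormalGroups

namespace PadicLogSeries

open Literature.AlgebraicGeometry.Resolution
open MvPowerSeries (truncTotal)

variable {p : ℕ} [hp : Fact p.Prime]

universe u

variable {B : Type u} [CommRing B] [IsDomain B] [CharZero B] (ι : ℤ_[p] →+* B) (b : ℕ → ℤ_[p])

/-! ## §1 The terms in the fraction field: `T_m = p^N · c_m · xᵐ` with `c_m = coeff_m f` -/

section FractionField

variable (K : Type u) [Field K] [Algebra B K] [IsFractionRing B K] [Algebra ℚ K] (f : PowerSeries ℚ)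

omit [IsDomain B] in
/-- **In the fraction field, `T_m(x,z) = p^N · c_m · xᵐ`** (`m ≥ 1`, `x^N = p z`), when the numerators `b` and the rational series
`f = Σ c_m Xᵐ` are related by `ι(b_m) = m · c_m` in `K`. [cite: Hazewinkel1978, Ch. I §2.1] -/
theorem algebraMap_term_eq (hbf : ∀ m : ℕ, algebraMap B K (ι (b m)) = (m : K) * algebraMap ℚ K (PowerSeries.coeff m f))
    {N : ℕ} (hN : 1 ≤ N) {x z : B} (hxz : x ^ N = (p : B) * z) {m : ℕ} (hm : m ≠ 0) :
    algebraMap B K (term ι b N x z m) =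
      (p : K) ^ N * algebraMap ℚ K (PowerSeries.coeff m f) * algebraMap B K x ^ m := by
  haveI : CharZero K := charZero_of_injective_algebraMap (IsFractionRing.injective B K)
  have hmK : (m : K) ≠ 0 := Nat.cast_ne_zero.2 hm
  refine mul_left_cancel₀ hmK ?_
  have h := congrArg (algebraMap B K) (natCast_mul_term ι b hN hxz hm)
  rw [map_mul, map_natCast] at h
  rw [h]
  simp only [map_mul, map_pow, map_natCast, hbf m]
  ring

omit [IsDomain B] in
/-- **The partial sums in the fraction field**: `S_M(x,z) = p^N · Σ_{m<M} c_{m+1} x^{m+1}`. [cite: Hazewinkel1978, Ch. I §2.1] -/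
theorem algebraMap_partialSum_eq (hbf : ∀ m : ℕ, algebraMap B K (ι (b m)) = (m : K) * algebraMap ℚ K (PowerSeries.coeff m f))
    {N : ℕ} (hN : 1 ≤ N) {x z : B} (hxz : x ^ N = (p : B) * z) (M : ℕ) :
    algebraMap B K (partialSum ι b N x z M) =
      (p : K) ^ N * ∑ m ∈ Finset.range M, algebraMap ℚ K (PowerSeries.coeff (m + 1) f) * algebraMap B K x ^ (m + 1) := by
  rw [partialSum, map_sum, Finset.mul_sum]
  refine Finset.sum_congr rfl fun m _ => ?_
  rw [algebraMap_term_eq ι b K f hbf hN hxz (Nat.add_one_ne_zero m)]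
  ring

end FractionField

/-! ## §2 `p`-adic bookkeeping for the truncation `M = 4nN` -/

/-- `v_p(k) ≤ n + N` for `1 ≤ k ≤ 4nN` (`2^v ≤ k ≤ 4nN ≤ 2^{n+N}`). [cite: Colmez1992PeriodesAbeliennes, §2] -/
theorem factorization_le_of_le_mul {n N k : ℕ} (hk : k ≠ 0) (hkM : k ≤ 4 * n * N) : k.factorization p ≤ n + N := by
  have h1 : p ^ k.factorization p ≤ k := Nat.ordProj_le p hk
  have h2 : 2 ^ k.factorization p ≤ p ^ k.factorization p := Nat.pow_le_pow_left hp.out.two_le _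
  have hn : 1 ≤ n := by
    rcases Nat.eq_zero_or_pos n with rfl | h
    · simp at hkM; exact (hk hkM).elim
    · exact h
  have hN : 1 ≤ N := by
    rcases Nat.eq_zero_or_pos N with rfl | h
    · simp at hkM; exact (hk hkM).elim
    · exact h
  have hn' : n ≤ 2 ^ (n - 1) := by have := @Nat.lt_two_pow_self (n - 1); omega
  have hN' : N ≤ 2 ^ (N - 1) := by have := @Nat.lt_two_pow_self (N - 1); omega
  have h3 : 4 * n * N ≤ 2 ^ (n + N) := by
    calc 4 * n * N ≤ 4 * 2 ^ (n - 1) * 2 ^ (N - 1) := Nat.mul_le_mul (Nat.mul_le_mul_left 4 hn') hN'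
      _ = 2 ^ (2 + (n - 1) + (N - 1)) := by rw [pow_add, pow_add]; norm_num
      _ = 2 ^ (n + N) := by congr 1; omega
  have h4 : 2 ^ k.factorization p ≤ 2 ^ (n + N) := h2.trans (h1.trans (hkM.trans h3))
  exact (Nat.pow_le_pow_iff_right (by norm_num : 1 < 2)).1 h4

/-! ## §3 The truncated functional equation in `B`: `S_M(G_D(y)) − S_M(y₀) − S_M(y₁) ∈ p^{N+n} B` -/

omit hp [IsDomain B] [CharZero B] in
/-- The ideal `(y₀, y₁)` of two `p`-nilpotent elements of index `N` has `(y₀,y₁)^{2N} ⊆ (p)`. [folklore] -/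
private theorem span_pair_pow_le {N : ℕ} {y : Fin 2 → B} {z : Fin 2 → B} (hyz : ∀ i, y i ^ N = (p : B) * z i) :
    (Ideal.span {y 0} ⊔ Ideal.span {y 1}) ^ (N + N) ≤ Ideal.span {(p : B)} := by
  refine (Ideal.sup_pow_add_le_pow_sup_pow).trans (sup_le ?_ ?_)
  · rw [Ideal.span_singleton_pow, Ideal.span_singleton_le_iff_mem, Ideal.mem_span_singleton']
    exact ⟨z 0, by rw [hyz 0, mul_comm]⟩
  · rw [Ideal.span_singleton_pow, Ideal.span_singleton_le_iff_mem, Ideal.mem_span_singleton']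
    exact ⟨z 1, by rw [hyz 1, mul_comm]⟩

omit hp [IsDomain B] [CharZero B] in
/-- `(y₀,y₁)^{2Nq} ⊆ (p)^q`. [folklore] -/
private theorem span_pair_pow_mul_le {N : ℕ} {y : Fin 2 → B} {z : Fin 2 → B} (hyz : ∀ i, y i ^ N = (p : B) * z i) (q : ℕ) :
    (Ideal.span {y 0} ⊔ Ideal.span {y 1}) ^ ((N + N) * q) ≤ Ideal.span {(p : B)} ^ q := by
  rw [pow_mul]
  exact Ideal.pow_right_mono (span_pair_pow_le hyz) q

omit [IsDomain B] [CharZero B] in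
/-- `y i ∈ (y₀, y₁)`. [folklore] -/
private theorem mem_span_pair (y : Fin 2 → B) : ∀ i : Fin 2, y i ∈ Ideal.span {y 0} ⊔ Ideal.span {y 1} := by
  intro i
  fin_cases i
  · exact Ideal.mem_sup_left (Ideal.mem_span_singleton_self _)
  · exact Ideal.mem_sup_right (Ideal.mem_span_singleton_self _)

omit hp [IsDomain B] [CharZero B] in
/-- A witness for the truncation `G_D(y)`: `G_D(y)^{2N} ∈ (p)`. [cite: SilvermanAEC2009, IV.2] -/
theorem exists_aeval_truncTotal_pow_eq {N : ℕ} {y : Fin 2 → B} {z : Fin 2 → B} (hyz : ∀ i, y i ^ N = (p : B) * z i)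
    {G : MvPowerSeries (Fin 2) ℤ} (hG0 : MvPowerSeries.constantCoeff G = 0) (D : ℕ) :
    ∃ z' : B, (MvPolynomial.aeval y (truncTotal (D + 1) G)) ^ (N + N) = (p : B) * z' := by
  have hmem := Literature.NumberTheory.PAdicHodge.LogTypeSeries.aeval_truncTotal_mem (mem_span_pair y) hG0 D
  have h := span_pair_pow_le hyz (Ideal.pow_mem_pow hmem (N + N))
  obtain ⟨z', hz'⟩ := Ideal.mem_span_singleton'.1 h
  exact ⟨z', by rw [← hz', mul_comm]⟩

/-- ★ **The truncated functional equation in `B`.** Let `f ∈ ℚ⟦X⟧` and `G ∈ ℤ⟦X₀,X₁⟧` with `G(0) = 0` satisfy `f(G) = f(X₀) + f(X₁)`,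
numerators `ι(b_m) = m·c_m` (in the fraction field), `y₀, y₁` `p`-nilpotent of index `N` with witnesses `z`, and `z'` a witness for
`g' = G_D(y)` at index `2N`. Then for `M = 4nN ≤ D`: **`S_M(g', z') − S_M(y₀) − S_M(y₁) = p^{N+n}·w`** (index `2N` throughout), because in
the fraction field the difference is `p^{2N} Σ_{m<M} c_{m+1} H_{m+1}(y)` with `H_{m+1}(y) ∈ (y₀,y₁)^{M+1} ⊆ p^{2n}B` and
`p^{2N} c_{m+1} = ι(b_{m+1}) p^{2N}/(m+1)`, `v_p(m+1) ≤ n + N`. [cite: SilvermanAEC2009, IV.5.2] [cite: Hazewinkel1978, Ch. I §2.1–2.3] -/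
theorem exists_partialSum_aeval_truncTotal_sub_eq (f : PowerSeries ℚ)
    (hbf : ∀ m : ℕ, algebraMap B (FractionRing B) (ι (b m)) =
      (m : FractionRing B) * algebraMap ℚ (FractionRing B) (PowerSeries.coeff m f))
    {G : MvPowerSeries (Fin 2) ℤ} (hG0 : MvPowerSeries.constantCoeff G = 0)
    (hfG : f.subst (MvPowerSeries.map (Int.castRingHom ℚ) G) =
      f.subst (MvPowerSeries.X 0 : MvPowerSeries (Fin 2) ℚ) + f.subst (MvPowerSeries.X 1 : MvPowerSeries (Fin 2) ℚ))
    {N : ℕ} (hN : 1 ≤ N) {y z : Fin 2 → B} (hyz : ∀ i, y i ^ N = (p : B) * z i) (n : ℕ) {D : ℕ} (hD : 4 * n * N ≤ D)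
    {z' : B} (hz' : (MvPolynomial.aeval y (truncTotal (D + 1) G)) ^ (N + N) = (p : B) * z') :
    ∃ w : B, partialSum ι b (N + N) (MvPolynomial.aeval y (truncTotal (D + 1) G)) z' (4 * n * N) -
        partialSum ι b (N + N) (y 0) (z 0 * y 0 ^ N) (4 * n * N) - partialSum ι b (N + N) (y 1) (z 1 * y 1 ^ N) (4 * n * N) =
      (p : B) ^ (N + n) * w := by
  set K := FractionRing B
  haveI : CharZero K := charZero_of_injective_algebraMap (IsFractionRing.injective B K)
  set M := 4 * n * N with hM
  have hNN : 1 ≤ N + N := by omega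
  have hyz2 : ∀ i, y i ^ (N + N) = (p : B) * (z i * y i ^ N) := fun i => by rw [pow_add, hyz i, mul_assoc]
  -- numerators over `K`: `(m+1) d = p^{n+N}` (possible since `v_p(m+1) ≤ n + N`) and `p^{n+N} c_{m+1} = ι(b_{m+1} d)`
  have hcoef : ∀ m : ℕ, m < M → ∃ d : ℤ_[p],
      (p : K) ^ (n + N) * algebraMap ℚ K (PowerSeries.coeff (m + 1) f) = algebraMap B K (ι (b (m + 1) * d)) := by
    intro m hmM
    have hv : (m + 1).factorization p ≤ n + N := factorization_le_of_le_mul (p := p) (Nat.add_one_ne_zero m) (by omega)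
    -- `(m+1) d = p^{n+N}` in `ℤ_p`
    obtain ⟨u, hu⟩ := PadicInt.isUnit_iff.2 (PadicInt.norm_natCast_eq_one_iff.2
      ((Nat.Prime.coprime_iff_not_dvd hp.out).2 (Nat.not_dvd_ordCompl hp.out (Nat.add_one_ne_zero m))))
    have hkm : p ^ (m + 1).factorization p * ((m + 1) / p ^ (m + 1).factorization p) = m + 1 :=
      Nat.ordProj_mul_ordCompl_eq_self (m + 1) p
    obtain ⟨d, hmd⟩ : ∃ d : ℤ_[p], ((m + 1 : ℕ) : ℤ_[p]) * d = (p : ℤ_[p]) ^ (n + N) := by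
      refine ⟨(p : ℤ_[p]) ^ (n + N - (m + 1).factorization p) * ((u⁻¹ : ℤ_[p]ˣ) : ℤ_[p]), ?_⟩
      calc ((m + 1 : ℕ) : ℤ_[p]) * ((p : ℤ_[p]) ^ (n + N - (m + 1).factorization p) * ((u⁻¹ : ℤ_[p]ˣ) : ℤ_[p]))
          = ((p ^ (m + 1).factorization p * ((m + 1) / p ^ (m + 1).factorization p) : ℕ) : ℤ_[p]) *
              ((p : ℤ_[p]) ^ (n + N - (m + 1).factorization p) * ((u⁻¹ : ℤ_[p]ˣ) : ℤ_[p])) := by rw [hkm]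
        _ = (p : ℤ_[p]) ^ (m + 1).factorization p * (p : ℤ_[p]) ^ (n + N - (m + 1).factorization p) *
              ((u : ℤ_[p]) * ((u⁻¹ : ℤ_[p]ˣ) : ℤ_[p])) := by rw [hu]; push_cast; ring
        _ = (p : ℤ_[p]) ^ (n + N) := by rw [← pow_add, Nat.add_sub_cancel' hv, Units.mul_inv, mul_one]
    refine ⟨d, ?_⟩
    have hm1K : ((m + 1 : ℕ) : K) ≠ 0 := Nat.cast_ne_zero.2 (Nat.add_one_ne_zero m)
    refine mul_left_cancel₀ hm1K ?_
    have hmdK : ((m + 1 : ℕ) : K) * algebraMap B K (ι d) = (p : K) ^ (n + N) := by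
      have h := congrArg (fun t : ℤ_[p] => algebraMap B K (ι t)) hmd
      simpa only [map_mul, map_natCast, map_pow] using h
    calc ((m + 1 : ℕ) : K) * ((p : K) ^ (n + N) * algebraMap ℚ K (PowerSeries.coeff (m + 1) f))
        = (p : K) ^ (n + N) * (((m + 1 : ℕ) : K) * algebraMap ℚ K (PowerSeries.coeff (m + 1) f)) := by ring
      _ = (p : K) ^ (n + N) * algebraMap B K (ι (b (m + 1))) := by rw [hbf (m + 1), Nat.cast_add, Nat.cast_one]
      _ = (((m + 1 : ℕ) : K) * algebraMap B K (ι d)) * algebraMap B K (ι (b (m + 1))) := by rw [hmdK]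
      _ = ((m + 1 : ℕ) : K) * algebraMap B K (ι (b (m + 1) * d)) := by simp only [map_mul]; ring
  -- the error terms `H_{m+1}(y) ∈ (y₀,y₁)^{M+1} ⊆ p^{2n}`
  have hH : ∀ m : ℕ, ∃ e : B, MvPolynomial.aeval y (truncTotal (D + 1) G ^ (m + 1) -
      truncTotal (M + 1) ((truncTotal (D + 1) G ^ (m + 1) : MvPolynomial (Fin 2) ℤ) : MvPowerSeries (Fin 2) ℤ)) =
        (p : B) ^ (2 * n) * e := by
    intro m
    have h1 := Literature.NumberTheory.PAdicHodge.LogTypeSeries.aeval_pow_sub_truncTotal_mem_pow (mem_span_pair y) G M D (m + 1)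
    have hle : (Ideal.span {y 0} ⊔ Ideal.span {y 1}) ^ (M + 1) ≤ Ideal.span {(p : B)} ^ (2 * n) :=
      (Ideal.pow_le_pow_right (by rw [hM]; nlinarith)).trans (span_pair_pow_mul_le hyz (2 * n))
    have h2 := hle h1
    rw [Ideal.span_singleton_pow, Ideal.mem_span_singleton'] at h2
    obtain ⟨e, he⟩ := h2
    exact ⟨e, by rw [← he, mul_comm]⟩
  choose d hd using hcoef
  choose e he using hH
  -- candidate
  refine ⟨∑ m ∈ Finset.range M, (if hm : m < M then ι (b (m + 1) * d m hm) else 0) * e m, ?_⟩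
  apply IsFractionRing.injective B K
  -- the identity in `K`
  have hid := Literature.NumberTheory.PAdicHodge.LogTypeSeries.aeval_sum_truncTotal_sub (B := K) f hG0 hfG
    (show M ≤ D by omega) (algebraMap B K ∘ y)
  simp only [MvPolynomial.aeval_algebraMap_apply, Function.comp_apply] at hid
  have hpK : (p : K) ^ (n + N) ≠ 0 := pow_ne_zero _ (Nat.cast_ne_zero.2 hp.out.ne_zero)
  rw [map_sub, map_sub, algebraMap_partialSum_eq ι b K f hbf hNN hz', algebraMap_partialSum_eq ι b K f hbf hNN (hyz2 0),
    algebraMap_partialSum_eq ι b K f hbf hNN (hyz2 1), ← mul_sub, ← mul_sub, hid, Finset.mul_sum, map_mul, map_pow, map_natCast,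
    map_sum, Finset.mul_sum]
  refine Finset.sum_congr rfl fun m hmr => ?_
  have hmM : m < M := Finset.mem_range.1 hmr
  rw [dif_pos hmM, he m]
  -- `p^{2N} · c_{m+1} · p^{2n} e = p^{N+n} · ι(b d) · e`, checked after multiplying by `p^{n+N}`
  refine mul_left_cancel₀ hpK ?_
  have hexp : n + N + (N + N) + 2 * n = n + N + (N + n) + (n + N) := by ring
  calc (p : K) ^ (n + N) * ((p : K) ^ (N + N) * (algebraMap ℚ K (PowerSeries.coeff (m + 1) f) *
          algebraMap B K ((p : B) ^ (2 * n) * e m)))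
      = (p : K) ^ (N + N) * algebraMap B K ((p : B) ^ (2 * n) * e m) *
          ((p : K) ^ (n + N) * algebraMap ℚ K (PowerSeries.coeff (m + 1) f)) := by ring
    _ = (p : K) ^ (N + N) * algebraMap B K ((p : B) ^ (2 * n) * e m) * algebraMap B K (ι (b (m + 1) * d m hmM)) := by
          rw [hd m hmM]
    _ = (p : K) ^ (n + N) * ((p : K) ^ (N + n) * (algebraMap B K (ι (b (m + 1) * d m hmM) * e m))) := by
          rw [map_mul (algebraMap B K) ((p : B) ^ (2 * n)) (e m), map_mul (algebraMap B K) (ι (b (m + 1) * d m hmM)) (e m),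
            map_pow, map_natCast]
          have : (p : K) ^ (N + N) * (p : K) ^ (2 * n) = (p : K) ^ (n + N) * (p : K) ^ (N + n) := by
            rw [← pow_add, ← pow_add]; congr 1; ring
          calc (p : K) ^ (N + N) * ((p : K) ^ (2 * n) * algebraMap B K (e m)) * algebraMap B K (ι (b (m + 1) * d m hmM))
              = ((p : K) ^ (N + N) * (p : K) ^ (2 * n)) * (algebraMap B K (ι (b (m + 1) * d m hmM)) * algebraMap B K (e m)) := by
                ring
            _ = _ := by rw [this]; ring

end PadicLogSeries

end Literature.RingTheory.FormalGroups

namespace Literature.RingTheory.FormalGroups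

namespace PadicLogSeries

open Literature.AlgebraicGeometry.Resolution
open MvPowerSeries (truncTotal)

variable {p : ℕ} [hp : Fact p.Prime]

universe u

variable {B : Type u} [CommRing B] [IsDomain B] [CharZero B] (ι : ℤ_[p] →+* B) (b : ℕ → ℤ_[p])

/-! ## §4 Additivity in `B^_(p)`: `Λ(G(y₀,y₁)) = Λ(y₀) + Λ(y₁)` -/

omit [IsDomain B] [CharZero B] in
/-- Congruent arguments give congruent partial sums: `x ≡ x'`, `z ≡ z' (mod pᵏ)` ⟹ `S_M(x,z) ≡ S_M(x',z') (mod pᵏ)` (the partial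
sums are polynomials in `(x, z)` with coefficients in `ι(ℤ_p)`). [cite: Colmez1992PeriodesAbeliennes, §2] -/
theorem partialSum_sub_partialSum_mem_of_sub_mem {N k : ℕ} {x z x' z' : B} (hx : x - x' ∈ Ideal.span {(p : B)} ^ k)
    (hz : z - z' ∈ Ideal.span {(p : B)} ^ k) (M : ℕ) :
    partialSum ι b N x z M - partialSum ι b N x' z' M ∈ Ideal.span {(p : B)} ^ k := by
  rw [← Ideal.Quotient.eq_zero_iff_mem, map_sub, sub_eq_zero, map_partialSum, map_partialSum,
    (Ideal.Quotient.eq).2 hx, (Ideal.Quotient.eq).2 hz]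

/-- If `p^j · X` vanishes modulo `pⁿ⁺ʲ` then `X` vanishes modulo `pⁿ` (`B` a domain). [folklore] -/
private theorem mem_pow_of_pow_mul_mem_pow {j n : ℕ} {x : B} (h : (p : B) ^ j * x ∈ Ideal.span {(p : B)} ^ (n + j)) :
    x ∈ Ideal.span {(p : B)} ^ n := by
  rw [Ideal.span_singleton_pow, Ideal.mem_span_singleton'] at h ⊢
  obtain ⟨w, hw⟩ := h
  refine ⟨w, mul_left_cancel₀ (pow_ne_zero j (Nat.cast_ne_zero.2 hp.out.ne_zero : (p : B) ≠ 0)) ?_⟩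
  rw [← hw, pow_add]; ring

/-- ★★ **Additivity of the `p`-adic log-type sums along a formal group law** (index `2N`). Let `f ∈ ℚ⟦X⟧`, `G ∈ ℤ⟦X₀,X₁⟧`
(`G(0) = 0`) with `f(G(X₀,X₁)) = f(X₀) + f(X₁)`, numerators `ι(b_m) = m · coeff_m f` (in the fraction field), `y₀, y₁ ∈ B`
`p`-nilpotent of index `N` (`yᵢ^N = p zᵢ`), and `g ∈ B` a `p`-ADIC VALUE of `G` at `(y₀, y₁)`: for every `k` and all large `D`,
`g ≡ G_D(y₀,y₁) (mod pᵏ)` (`G_D = truncTotal_{D+1} G`; e.g. the `(p,ξ)`-adic value in `𝔸_inf`), with a witness `g^{2N} = p z_g`. Then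
**`Λ_{2N}(g, z_g) = Λ_{2N}(y₀, z₀y₀^N) + Λ_{2N}(y₁, z₁y₁^N)`** in `B^_(p)` — `p`-adic evaluation of a formal-group logarithm is a
homomorphism (Colmez/Fontaine), here with Frobenius available on the target. [cite: SilvermanAEC2009, IV.5.2] [cite: Colmez1992PeriodesAbeliennes, §2] -/
theorem logSum_eq_add_of_forall_sub_aeval_mem (f : PowerSeries ℚ)
    (hbf : ∀ m : ℕ, algebraMap B (FractionRing B) (ι (b m)) =
      (m : FractionRing B) * algebraMap ℚ (FractionRing B) (PowerSeries.coeff m f))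
    {G : MvPowerSeries (Fin 2) ℤ} (hG0 : MvPowerSeries.constantCoeff G = 0)
    (hfG : f.subst (MvPowerSeries.map (Int.castRingHom ℚ) G) =
      f.subst (MvPowerSeries.X 0 : MvPowerSeries (Fin 2) ℚ) + f.subst (MvPowerSeries.X 1 : MvPowerSeries (Fin 2) ℚ))
    {N : ℕ} (hN : 1 ≤ N) {y z : Fin 2 → B} (hyz : ∀ i, y i ^ N = (p : B) * z i) {g zg : B}
    (hg : ∀ k : ℕ, ∃ D₀ : ℕ, ∀ D, D₀ ≤ D → g - MvPolynomial.aeval y (truncTotal (D + 1) G) ∈ Ideal.span {(p : B)} ^ k)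
    (hzg : g ^ (N + N) = (p : B) * zg) :
    logSum ι b (N + N) g zg = logSum ι b (N + N) (y 0) (z 0 * y 0 ^ N) + logSum ι b (N + N) (y 1) (z 1 * y 1 ^ N) := by
  have hNN : 1 ≤ N + N := by omega
  have hp0 : (p : B) ≠ 0 := Nat.cast_ne_zero.2 hp.out.ne_zero
  refine AdicCompletion.ext_evalₐ fun n => ?_
  set M := 4 * n * N with hM
  have hMn : 2 * n * (N + N) = M := by rw [hM]; ring
  rw [map_add, evalₐ_logSum ι b g zg hNN, evalₐ_logSum ι b (y 0) _ hNN, evalₐ_logSum ι b (y 1) _ hNN, ← map_add,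
    Ideal.Quotient.mk_eq_mk_iff_sub_mem, hMn]
  -- approximate `g` by `g' = G_D(y)` modulo `p^{n+1}`, `D ≥ M`
  obtain ⟨D₀, hD₀⟩ := hg (n + 1)
  set D := max D₀ M with hD
  have hgD := hD₀ D (le_max_left _ _)
  obtain ⟨z', hz'⟩ := exists_aeval_truncTotal_pow_eq hyz hG0 D
  set g' := MvPolynomial.aeval y (truncTotal (D + 1) G) with hg'
  -- the witnesses agree modulo `pⁿ`: `p (zg - z') = g^{2N} - g'^{2N} ∈ p^{n+1}`
  have hzz : zg - z' ∈ Ideal.span {(p : B)} ^ n := by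
    refine mem_pow_of_pow_mul_mem_pow (j := 1) ?_
    rw [pow_one, mul_sub, ← hzg, ← hz']
    have h := (Ideal.Quotient.eq).2 hgD
    rw [← Ideal.Quotient.eq, map_pow, map_pow, h]
  have hgg : g - g' ∈ Ideal.span {(p : B)} ^ n := Ideal.pow_le_pow_right (Nat.le_succ n) hgD
  -- `S_M(g, zg) ≡ S_M(g', z')` and `S_M(g', z') − S_M(y₀) − S_M(y₁) ∈ p^{N+n}`
  have h1 := partialSum_sub_partialSum_mem_of_sub_mem ι b (N := N + N) hgg hzz M
  obtain ⟨w, hw⟩ := exists_partialSum_aeval_truncTotal_sub_eq ι b f hbf hG0 hfG hN hyz n (le_max_right _ _) hz'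
  have h2 : partialSum ι b (N + N) g' z' M - partialSum ι b (N + N) (y 0) (z 0 * y 0 ^ N) M -
      partialSum ι b (N + N) (y 1) (z 1 * y 1 ^ N) M ∈ Ideal.span {(p : B)} ^ n := by
    rw [hg', hM, hw]
    exact Ideal.mul_mem_right _ _ (Ideal.pow_le_pow_right (Nat.le_add_left n N) (Ideal.pow_mem_pow (Ideal.mem_span_singleton_self _) _))
  have : partialSum ι b (N + N) g zg M - (partialSum ι b (N + N) (y 0) (z 0 * y 0 ^ N) M +
      partialSum ι b (N + N) (y 1) (z 1 * y 1 ^ N) M) =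
      (partialSum ι b (N + N) g zg M - partialSum ι b (N + N) g' z' M) +
        (partialSum ι b (N + N) g' z' M - partialSum ι b (N + N) (y 0) (z 0 * y 0 ^ N) M -
          partialSum ι b (N + N) (y 1) (z 1 * y 1 ^ N) M) := by ring
  rw [this]
  exact Ideal.add_mem _ h1 h2

/-! ## §5 Descent of the exponent: the index-`N` statement -/

/-- **`p`-torsion-freeness of `B^_(p)` at every level**: if `p^j · X = 0` in `B^_(p)` then `X = 0` (`B` a domain).
[cite: BergerLaurent2002, §1.2] -/
theorem eq_zero_of_pow_mul_eq_zero {j : ℕ} {X : AdicCompletion (Ideal.span {(p : B)}) B}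
    (h : AdicCompletion.of (Ideal.span {(p : B)}) B ((p : B) ^ j) * X = 0) : X = 0 := by
  refine AdicCompletion.ext_evalₐ fun n => ?_
  rw [map_zero]
  have hle : n ≤ n + j := Nat.le_add_right n j
  have hc := factorPow_evalₐ (Ideal.span {(p : B)}) hle X
  obtain ⟨x, hx⟩ := Ideal.Quotient.mk_surjective (AdicCompletion.evalₐ (Ideal.span {(p : B)}) (n + j) X)
  have hnj := congrArg (AdicCompletion.evalₐ (Ideal.span {(p : B)}) (n + j)) h
  rw [map_mul, map_zero, AdicCompletion.evalₐ_of, ← hx, ← map_mul, Ideal.Quotient.eq_zero_iff_mem] at hnj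
  have hx' : x ∈ Ideal.span {(p : B)} ^ n := mem_pow_of_pow_mul_mem_pow (by rwa [add_comm] at hnj)
  rw [← hc, ← hx, Ideal.Quotient.factorPow, Ideal.Quotient.factor_mk, Ideal.Quotient.eq_zero_iff_mem]
  exact hx'

/-- ★★ **Additivity at index `N`**: under the hypotheses of `logSum_eq_add_of_forall_sub_aeval_mem` and with a witness `g^N = p z_g'`
at index `N`, **`Λ_N(g) = Λ_N(y₀) + Λ_N(y₁)`** (from the index-`2N` statement, `Λ_{2N} = p^N Λ_N`, and `p`-torsion-freeness of `B^_(p)`).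
[cite: SilvermanAEC2009, IV.5.2] [cite: Colmez1992PeriodesAbeliennes, §2] -/
theorem logSum_eq_add_of_forall_sub_aeval_mem' (f : PowerSeries ℚ)
    (hbf : ∀ m : ℕ, algebraMap B (FractionRing B) (ι (b m)) =
      (m : FractionRing B) * algebraMap ℚ (FractionRing B) (PowerSeries.coeff m f))
    {G : MvPowerSeries (Fin 2) ℤ} (hG0 : MvPowerSeries.constantCoeff G = 0)
    (hfG : f.subst (MvPowerSeries.map (Int.castRingHom ℚ) G) =
      f.subst (MvPowerSeries.X 0 : MvPowerSeries (Fin 2) ℚ) + f.subst (MvPowerSeries.X 1 : MvPowerSeries (Fin 2) ℚ))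
    {N : ℕ} (hN : 1 ≤ N) {y z : Fin 2 → B} (hyz : ∀ i, y i ^ N = (p : B) * z i) {g zg : B}
    (hg : ∀ k : ℕ, ∃ D₀ : ℕ, ∀ D, D₀ ≤ D → g - MvPolynomial.aeval y (truncTotal (D + 1) G) ∈ Ideal.span {(p : B)} ^ k)
    (hzg : g ^ N = (p : B) * zg) :
    logSum ι b N g zg = logSum ι b N (y 0) (z 0) + logSum ι b N (y 1) (z 1) := by
  have hNN : N ≤ N + N := Nat.le_add_right N N
  have hzg2 : g ^ (N + N) = (p : B) * (zg * g ^ N) := by rw [pow_add, hzg, mul_assoc]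
  have h2 := logSum_eq_add_of_forall_sub_aeval_mem ι b f hbf hG0 hfG hN hyz hg hzg2
  have hyz2 : ∀ i, y i ^ (N + N) = (p : B) * (z i * y i ^ N) := fun i => by rw [pow_add, hyz i, mul_assoc]
  rw [logSum_eq_pow_mul_logSum ι b hN hNN hzg hzg2, logSum_eq_pow_mul_logSum ι b hN hNN (hyz 0) (hyz2 0),
    logSum_eq_pow_mul_logSum ι b hN hNN (hyz 1) (hyz2 1), ← mul_add, ← sub_eq_zero, ← mul_sub] at h2
  exact sub_eq_zero.1 (eq_zero_of_pow_mul_eq_zero h2)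

end PadicLogSeries

end Literature.RingTheory.FormalGroups

end
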